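import Summits.HodgeConjecture.CorCM.QuarticCMSameFieldPairs
import HarnessLib

/-!
# The dihedral surface triple, II: the balanced `4`-set `{(0,p), (1,u), (1,v), (2,p′∘e)}` is a Pohlmann set of the
# CM algebra `K₀ × K₁ × K₂` and is not a disjoint union of balanced pairs

COR-CM (cell `pub-hodgecm2`, seat p2 gen 19, count-neutral claim DIHEDRAL-TRIPLE, file 2 of 3); NEW as stated, hence
under `Summits/`.  Theorems only; no definition, no named fact, no `sorry`.  Pure bookkeeping on the index set
`Hom(K₀, ℂ) ⊔ Hom(K₁, ℂ) ⊔ Hom(K₂, ℂ)` of a three-slot family `Φ` of CM types over `Fin 3` with `[K₀:ℚ] = [K₁:ℚ] = 4`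
and `e : K₂ ≃ K₀`, GIVEN the vertex–edge duality datum of file I as a hypothesis (`hstab`: the stabiliser of the
embedding `q` of `K₀` is the stabiliser of `Ψ = Φ₁ = {u, v}`); consumed by `DihedralReflexTripleCMHodge`.

* **`mem_pohlmannSetsAlg_two`** — with `{o, ō}` the other pair of `Hom(K₀, ℂ)`, `p ∈ {q, q̄} ∖ Φ₀`, `p′∘e ∉ Φ₂`, and
  either `p′ = p` and `Φ₀`, `Φ₂∘e⁻¹` DIFFER on `{o, ō}`, or `p′ = p̄` and they AGREE there, the `4`-set
  `P = {(0,p), (1,u), (1,v), (2,p′∘e)}` is Galois-balanced (`Pohlmann1968.pohlmannSetsAlg Φ 2`): for `γq = q` the four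
  memberships `[γx ∈ type]` are `(0,1,1,0)`, for `γq = q̄` they are `(1,0,0,1)`, otherwise `γΨ ∉ {Ψ, Ψ̄}` meets `Ψ` in
  exactly one point and `γp, γp′` lie over `{o, ō}` — two out of four in every case.
* **`not_mem_pohlmannDivisorSetsAlg_two`** — `P ∉ pohlmannDivisorSetsAlg Φ 2` (given a swap `σ` of `u, v` fixing `p`,
  `p ∉ Φ₀`, `p′∘e ∉ Φ₂`, `K₁/ℚ` non-Galois quartic): the balanced pair through `(0,p)` would have partner `(2,p′∘e)`
  (count `0` at `γ = 1`), `(1,u)` (the reflection `s_u` of `K₁` fixing `u` and `s_u σ` force count `0`) or `(1,v)`.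

## References
* [Pohlmann1968] H. Pohlmann, *Algebraic cycles on abelian varieties of complex multiplication type*, Ann. of Math. 88
  (1968) 161–180, Thm. 1.
* [Gordon1999HodgeAVSurvey] B. B. Gordon, *A survey of the Hodge conjecture for abelian varieties*, 9.2.2.
* [Shimura1998] G. Shimura, *Abelian Varieties with Complex Multiplication and Modular Functions*, §8.4 Example (2)(C).
-/

noncomputable section

open CategoryTheory CategoryTheory.Limits NumberField NumberField.ComplexEmbedding IntermediateField
open scoped BigOperators

namespace Summit.HodgeConjecture.CorCM

open Literature.NumberTheory.ComplexMultiplication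
open Literature.NumberTheory.ComplexMultiplication.CMTypeOps (mem_iff_conjugate_notMem conjugate_mem_iff_notMem)
open Literature.AlgebraicGeometry.Motives (CMType)
open Literature.AlgebraicGeometry.Pohlmann1968
open QuarticCM QuarticCMPairs

namespace DihedralReflexTriple

/-! ### §2 The exceptional balanced `4`-set of the triple -/

section Counting

/-- `#{x ∈ s | Q x}` as a sum of indicators. [folklore] -/
private theorem ncard_sep_eq_sum {α : Type*} (s : Finset α) (Q : α → Prop) [DecidablePred Q] :
    {x | x ∈ s ∧ Q x}.ncard = ∑ x ∈ s, if Q x then 1 else 0 := by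
  have h : {x | x ∈ s ∧ Q x} = ↑(s.filter Q) := by
    ext x
    simp
  rw [h, Set.ncard_coe_finset, Finset.card_filter]

/-- A sum over four distinct points. [folklore] -/
private theorem sum_quad {α N : Type*} [DecidableEq α] [AddCommMonoid N] {a b c d : α} (hab : a ≠ b) (hac : a ≠ c)
    (had : a ≠ d) (hbc : b ≠ c) (hbd : b ≠ d) (hcd : c ≠ d) (f : α → N) :
    ∑ x ∈ ({a, b, c, d} : Finset α), f x = f a + f b + f c + f d := by
  rw [Finset.sum_insert (by simp [hab, hac, had]), Finset.sum_insert (by simp [hbc, hbd]), Finset.sum_pair hcd]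
  simp only [add_assoc]

/-- Four distinct points form a `4`-set. [folklore] -/
private theorem card_quad {α : Type*} [DecidableEq α] {a b c d : α} (hab : a ≠ b) (hac : a ≠ c) (had : a ≠ d)
    (hbc : b ≠ c) (hbd : b ≠ d) (hcd : c ≠ d) : ({a, b, c, d} : Finset α).card = 4 := by
  rw [Finset.card_insert_of_notMem (by simp [hab, hac, had]), Finset.card_insert_of_notMem (by simp [hbc, hbd]),
    Finset.card_pair hcd]

/-- The three balance patterns `(0,1,1,0)`, `(1,0,0,1)`, "one of `A, D` and one of `B, C`" give two out of four.
[folklore] -/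
private theorem ite_balance {A B C D : Prop} [Decidable A] [Decidable B] [Decidable C] [Decidable D]
    (h : (¬A ∧ B ∧ C ∧ ¬D) ∨ (A ∧ ¬B ∧ ¬C ∧ D) ∨ ((A ↔ ¬D) ∧ (B ↔ ¬C))) :
    (if A then 1 else 0) + (if B then 1 else 0) + (if C then 1 else 0) + (if D then 1 else 0) =
      (if ¬A then 1 else 0) + (if ¬B then 1 else 0) + (if ¬C then 1 else 0) + (if ¬D then 1 else 0) := by
  by_cases hA : A <;> by_cases hB : B <;> by_cases hC : C <;> by_cases hD : D <;> simp_all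

/-- A balanced pair has exactly one member in the type. [folklore] -/
private theorem iff_not_of_ite_add {A B : Prop} [Decidable A] [Decidable B]
    (h : (if A then 1 else 0) + (if B then 1 else 0) = (if ¬A then 1 else 0) + (if ¬B then 1 else 0)) :
    A ↔ ¬B := by
  by_cases hA : A <;> by_cases hB : B <;> simp_all

end Counting

section Triple

variable {K : Fin 3 → Type} [∀ j, Field (K j)] [∀ j, NumberField (K j)] [∀ j, IsCMField (K j)]

open scoped Classical in
/-- **The `4`-set `P = {(0,p), (1,u), (1,v), (2,p′∘e)}` is Galois-balanced.**  Here `Ψ = Φ₁ = {u, v}`, `q` is an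
embedding of `K₀` whose stabiliser in `Aut(ℂ)` is the stabiliser of `{u, v}` (§1), `{o, ō}` is the other pair,
`p ∈ {q, q̄} ∖ Φ₀`, and either `p′ = p` and `Φ₀`, `Φ₂ ∘ e⁻¹` differ on `{o, ō}`, or `p′ = p̄` and they agree there.  For
`γq = q` the memberships are `(0,1,1,0)`, for `γq = q̄` they are `(1,0,0,1)`, otherwise `γΨ ∉ {Ψ, Ψ̄}` meets `Ψ` once and
`γp, γp′` lie over `{o, ō}`. [cite: Pohlmann1968, Thm. 1] [cite: Gordon1999HodgeAVSurvey, 9.2.2] -/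
theorem mem_pohlmannSetsAlg_two (h4₀ : Module.finrank ℚ (K 0) = 4) (Φ : ∀ j, CMType (K j)) (e : K 2 ≃+* K 0)
    {u v : K 1 →+* ℂ} (hvu : v ≠ u) (hΨ : ∀ t, t ∈ (Φ 1).1 ↔ t = u ∨ t = v)
    {q o : K 0 →+* ℂ} (hoq : o ≠ q) (hoq' : o ≠ conjugate q)
    (hstab : ∀ γ : ℂ ≃+* ℂ, γ • q = q ↔ (γ • u = u ∧ γ • v = v) ∨ (γ • u = v ∧ γ • v = u))
    {p p' : K 0 →+* ℂ} (hp : p = q ∨ p = conjugate q) (hpΦ : p ∉ (Φ 0).1)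
    (hp'Φ : p'.comp e.toRingHom ∉ (Φ 2).1)
    (hK : (p' = p ∧ ∀ w, w = o ∨ w = conjugate o → (w ∈ (Φ 0).1 ↔ w.comp e.toRingHom ∉ (Φ 2).1)) ∨
      (p' = conjugate p ∧ ∀ w, w = o ∨ w = conjugate o → (w ∈ (Φ 0).1 ↔ w.comp e.toRingHom ∈ (Φ 2).1))) :
    ({⟨0, p⟩, ⟨1, u⟩, ⟨1, v⟩, ⟨2, p'.comp e.toRingHom⟩} : Finset ((j : Fin 3) × (K j →+* ℂ))) ∈
      pohlmannSetsAlg Φ 2 := by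
  -- the four points are distinct
  have hab : (⟨0, p⟩ : (j : Fin 3) × (K j →+* ℂ)) ≠ ⟨1, u⟩ := fun h => absurd (congrArg Sigma.fst h) (by simp)
  have hac : (⟨0, p⟩ : (j : Fin 3) × (K j →+* ℂ)) ≠ ⟨1, v⟩ := fun h => absurd (congrArg Sigma.fst h) (by simp)
  have had : (⟨0, p⟩ : (j : Fin 3) × (K j →+* ℂ)) ≠ ⟨2, p'.comp e.toRingHom⟩ :=
    fun h => absurd (congrArg Sigma.fst h) (by simp)
  have hbc : (⟨1, u⟩ : (j : Fin 3) × (K j →+* ℂ)) ≠ ⟨1, v⟩ :=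
    fun h => hvu (eq_of_heq (Sigma.mk.inj_iff.1 h).2).symm
  have hbd : (⟨1, u⟩ : (j : Fin 3) × (K j →+* ℂ)) ≠ ⟨2, p'.comp e.toRingHom⟩ :=
    fun h => absurd (congrArg Sigma.fst h) (by simp)
  have hcd : (⟨1, v⟩ : (j : Fin 3) × (K j →+* ℂ)) ≠ ⟨2, p'.comp e.toRingHom⟩ :=
    fun h => absurd (congrArg Sigma.fst h) (by simp)
  refine ⟨card_quad hab hac had hbc hbd hcd, fun τ => ?_⟩
  rw [ncard_sep_eq_sum, ncard_sep_eq_sum, sum_quad hab hac had hbc hbd hcd, sum_quad hab hac had hbc hbd hcd]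
  change (if τ • p ∈ (Φ 0).1 then 1 else 0) + (if τ • u ∈ (Φ 1).1 then 1 else 0) +
      (if τ • v ∈ (Φ 1).1 then 1 else 0) + (if τ • p'.comp e.toRingHom ∈ (Φ 2).1 then 1 else 0) =
    (if ¬(τ • p ∈ (Φ 0).1) then 1 else 0) + (if ¬(τ • u ∈ (Φ 1).1) then 1 else 0) +
      (if ¬(τ • v ∈ (Φ 1).1) then 1 else 0) + (if ¬(τ • p'.comp e.toRingHom ∈ (Φ 2).1) then 1 else 0)
  apply ite_balance
  -- bookkeeping on `Ψ = {u, v}`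
  have huv : u ≠ v := hvu.symm
  have hu : u ∈ (Φ 1).1 := (hΨ u).2 (Or.inl rfl)
  have hv : v ∈ (Φ 1).1 := (hΨ v).2 (Or.inr rfl)
  have hnu : conjugate u ∉ (Φ 1).1 := (mem_iff_conjugate_notMem _ u).1 hu
  have hnv : conjugate v ∉ (Φ 1).1 := (mem_iff_conjugate_notMem _ v).1 hv
  -- `τ` acts on `p, p′` as on `q` (resp. conjugate)
  have hτp_of_fix : τ • q = q → τ • p = p := fun h => by
    rcases hp with rfl | rfl
    · exact h
    · rw [smul_conjugate, h]
  have hτp_of_conj : τ • q = conjugate q → τ • p = conjugate p := fun h => by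
    rcases hp with rfl | rfl
    · exact h
    · rw [smul_conjugate, h, involutive_conjugate]
  have hp' : p' = p ∨ p' = conjugate p := hK.elim (fun h => Or.inl h.1) fun h => Or.inr h.1
  have hτp'_of_fix : τ • q = q → τ • p' = p' := fun h => by
    rcases hp' with rfl | rfl
    · exact hτp_of_fix h
    · rw [smul_conjugate, hτp_of_fix h]
  have hτp'_of_conj : τ • q = conjugate q → τ • p' = conjugate p' := fun h => by
    rcases hp' with rfl | rfl
    · exact hτp_of_conj h
    · rw [smul_conjugate, hτp_of_conj h, involutive_conjugate]
  rw [smul_comp_ringEquiv]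
  obtain ⟨hōq, hōq'⟩ : conjugate o ≠ q ∧ conjugate o ≠ conjugate q :=
    ⟨fun h => hoq' (by rw [← h, involutive_conjugate]), fun h => hoq ((involutive_conjugate (K 0)).injective h)⟩
  rcases eq_or_eq_or_eq_or_eq h4₀ hoq hoq' (τ • q) with h | h | hτq | hτq
  · -- `τ q = q`: pattern `(0, 1, 1, 0)`
    refine Or.inl ⟨by rw [hτp_of_fix h]; exact hpΦ, ?_, ?_, by rw [hτp'_of_fix h]; exact hp'Φ⟩
    · rcases (hstab τ).1 h with ⟨h1, -⟩ | ⟨h1, -⟩ <;> rw [h1]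
      exacts [hu, hv]
    · rcases (hstab τ).1 h with ⟨-, h2⟩ | ⟨-, h2⟩ <;> rw [h2]
      exacts [hv, hu]
  · -- `τ q = q̄`: pattern `(1, 0, 0, 1)`
    have hc : ((starRingAut : ℂ ≃+* ℂ) * τ) • q = q := by
      rw [mul_smul, h, conj_smul_eq_conjugate, involutive_conjugate]
    have hcu : τ • u = conjugate (((starRingAut : ℂ ≃+* ℂ) * τ) • u) := by
      rw [mul_smul, conj_smul_eq_conjugate, involutive_conjugate]
    have hcv : τ • v = conjugate (((starRingAut : ℂ ≃+* ℂ) * τ) • v) := by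
      rw [mul_smul, conj_smul_eq_conjugate, involutive_conjugate]
    refine Or.inr (Or.inl ⟨?_, ?_, ?_, ?_⟩)
    · rw [hτp_of_conj h]
      exact (conjugate_mem_iff_notMem _ p).2 hpΦ
    · rw [hcu]
      rcases (hstab _).1 hc with ⟨h1, -⟩ | ⟨h1, -⟩ <;> rw [h1]
      exacts [hnu, hnv]
    · rw [hcv]
      rcases (hstab _).1 hc with ⟨-, h2⟩ | ⟨-, h2⟩ <;> rw [h2]
      exacts [hnv, hnu]
    · rw [hτp'_of_conj h, ← conjugate_comp_ringEquiv]
      exact (conjugate_mem_iff_notMem _ _).2 hp'Φ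
  all_goals
    -- `τ q ∈ {o, ō}`: neither `τ` nor `ρτ` stabilises `{u, v}`
    have hτq' : τ • q ≠ q ∧ τ • q ≠ conjugate q := by
      rw [hτq]; first | exact ⟨hoq, hoq'⟩ | exact ⟨hōq, hōq'⟩
    have hn1 : ¬((τ • u = u ∧ τ • v = v) ∨ (τ • u = v ∧ τ • v = u)) := fun h' => hτq'.1 ((hstab τ).2 h')
    have hn2 : ¬((((starRingAut : ℂ ≃+* ℂ) * τ) • u = u ∧ ((starRingAut : ℂ ≃+* ℂ) * τ) • v = v) ∨
        (((starRingAut : ℂ ≃+* ℂ) * τ) • u = v ∧ ((starRingAut : ℂ ≃+* ℂ) * τ) • v = u)) := fun h' => by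
      have := (hstab _).2 h'
      rw [mul_smul, conj_smul_eq_conjugate] at this
      have h2 := congrArg conjugate this
      rw [involutive_conjugate] at h2
      exact hτq'.2 h2
    refine Or.inr (Or.inr ⟨?_, ?_⟩)
    · -- the `K`-slots: `τp ∈ {o, ō}`
      have hw : τ • p = o ∨ τ • p = conjugate o := by
        rcases hp with rfl | rfl
        · rw [hτq]
          first | exact Or.inl rfl | exact Or.inr rfl
        · rw [smul_conjugate, hτq]
          first | exact Or.inr rfl | (rw [involutive_conjugate]; exact Or.inl rfl)
      rcases hK with ⟨rfl, hKo⟩ | ⟨rfl, hKo⟩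
      · exact hKo _ hw
      · rw [smul_conjugate, ← conjugate_comp_ringEquiv, conjugate_mem_iff_notMem, not_not]
        exact hKo _ hw
    · -- the `M`-slot: exactly one of `τu, τv` in `Ψ`
      constructor
      · intro hτu hτv
        rcases (hΨ _).1 hτu with h1 | h1 <;> rcases (hΨ _).1 hτv with h2 | h2
        · exact huv (smul_left_cancel τ (h1.trans h2.symm))
        · exact hn1 (Or.inl ⟨h1, h2⟩)
        · exact hn1 (Or.inr ⟨h1, h2⟩)
        · exact huv (smul_left_cancel τ (h1.trans h2.symm))
      · intro hτv
        by_contra hτu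
        have h1' := (conjugate_mem_iff_notMem _ _).2 hτu
        have h2' := (conjugate_mem_iff_notMem _ _).2 hτv
        rw [← conj_smul_eq_conjugate, ← mul_smul] at h1' h2'
        rcases (hΨ _).1 h1' with h1 | h1 <;> rcases (hΨ _).1 h2' with h2 | h2
        · exact huv (smul_left_cancel _ (h1.trans h2.symm))
        · exact hn2 (Or.inl ⟨h1, h2⟩)
        · exact hn2 (Or.inr ⟨h1, h2⟩)
        · exact huv (smul_left_cancel _ (h1.trans h2.symm))

open scoped Classical in
/-- **`P` is not a disjoint union of two balanced pairs.**  The balanced pair through `(0, p)` would have partner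
`(2, p′∘e)` — but then the identity of `ℂ` counts `0` members in the types (`p ∉ Φ₀`, `p′∘e ∉ Φ₂`) — or `(1, u)`: the
reflection `s_u` of `M` (`u ↦ u`, `v ↦ v̄`) gives `s_u p ∉ Φ₀`, and then `s_u σ` (`u ↦ v̄ ∉ Ψ`, `p ↦ s_u p ∉ Φ₀`) counts
`0` — or `(1, v)`, symmetrically. [cite: Gordon1999HodgeAVSurvey, 9.2.2] -/
theorem not_mem_pohlmannDivisorSetsAlg_two (h4₁ : Module.finrank ℚ (K 1) = 4) (hK₁ : ¬IsGalois ℚ (K 1))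
    (Φ : ∀ j, CMType (K j)) (e : K 2 ≃+* K 0) {u v : K 1 →+* ℂ} (hvu : v ≠ u) (hvu' : v ≠ conjugate u)
    (hΨ : ∀ t, t ∈ (Φ 1).1 ↔ t = u ∨ t = v) {σ : ℂ ≃+* ℂ} (hσu : σ • u = v) (hσv : σ • v = u)
    {p p' : K 0 →+* ℂ} (hσp : σ • p = p) (hpΦ : p ∉ (Φ 0).1) (hp'Φ : p'.comp e.toRingHom ∉ (Φ 2).1) :
    ({⟨0, p⟩, ⟨1, u⟩, ⟨1, v⟩, ⟨2, p'.comp e.toRingHom⟩} : Finset ((j : Fin 3) × (K j →+* ℂ))) ∉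
      pohlmannDivisorSetsAlg Φ 2 := by
  set P : Finset ((j : Fin 3) × (K j →+* ℂ)) := {⟨0, p⟩, ⟨1, u⟩, ⟨1, v⟩, ⟨2, p'.comp e.toRingHom⟩} with hPdef
  intro hP
  rw [pohlmannDivisorSetsAlg_def] at hP
  obtain ⟨s, hs, t, ht, hst, hPst⟩ := mem_disjointUnionsOf_succ.1 hP
  obtain ⟨s', hs', t', ht', hst', rfl⟩ := mem_disjointUnionsOf_succ.1 hs
  rw [mem_disjointUnionsOf_zero] at hs'
  subst hs'
  have hmem : (⟨0, p⟩ : (j : Fin 3) × (K j →+* ℂ)) ∈ P := by simp [hPdef]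
  -- a balanced pair `T ⊆ P` through `(0, p)`
  obtain ⟨T, hT, hpT, hTP⟩ : ∃ T ∈ pohlmannSetsAlg Φ 1, (⟨0, p⟩ : (j : Fin 3) × (K j →+* ℂ)) ∈ T ∧ T ⊆ P := by
    rw [hPst, Finset.mem_disjUnion, Finset.mem_disjUnion] at hmem
    rcases hmem with (h | h) | h
    · exact absurd h (Finset.notMem_empty _)
    · exact ⟨t', ht', h, fun x hx => by
        rw [hPst]; exact Finset.mem_disjUnion.2 (Or.inl (Finset.mem_disjUnion.2 (Or.inr hx)))⟩
    · exact ⟨t, ht, h, fun x hx => by rw [hPst]; exact Finset.mem_disjUnion.2 (Or.inr hx)⟩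
  obtain ⟨hTcard, hTbal⟩ := hT
  obtain ⟨x, y, hxy, hTxy⟩ := Finset.card_eq_two.1 (by simpa using hTcard)
  obtain ⟨w, hw0, hwP, hbal⟩ : ∃ w, w ≠ (⟨0, p⟩ : (j : Fin 3) × (K j →+* ℂ)) ∧ w ∈ P ∧
      IsGaloisBalancedAlg Φ {⟨0, p⟩, w} := by
    rw [hTxy] at hpT hTP hTbal
    simp only [Finset.mem_insert, Finset.mem_singleton] at hpT
    rcases hpT with rfl | rfl
    · exact ⟨y, hxy.symm, hTP (by simp), hTbal⟩
    · exact ⟨x, hxy, hTP (by simp), by rwa [Finset.pair_comm] at hTbal⟩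
  -- exactly one member of the pair lies in the types, for every `γ`
  have hone : ∀ γ : ℂ ≃+* ℂ, γ • p ∈ (Φ 0).1 ↔ ¬(γ : ℂ →+* ℂ).comp w.2 ∈ (Φ w.1).1 := by
    intro γ
    have h := hbal γ
    rw [ncard_sep_eq_sum, ncard_sep_eq_sum, Finset.sum_pair hw0.symm, Finset.sum_pair hw0.symm] at h
    exact iff_not_of_ite_add h
  -- bookkeeping on `Ψ`
  have huv : u ≠ v := hvu.symm
  have huv' : u ≠ conjugate v := fun h => hvu' (by rw [h, involutive_conjugate])
  have hu : u ∈ (Φ 1).1 := (hΨ u).2 (Or.inl rfl)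
  have hv : v ∈ (Φ 1).1 := (hΨ v).2 (Or.inr rfl)
  have hnu : conjugate u ∉ (Φ 1).1 := (mem_iff_conjugate_notMem _ u).1 hu
  have hnv : conjugate v ∉ (Φ 1).1 := (mem_iff_conjugate_notMem _ v).1 hv
  have hwP' : w = ⟨0, p⟩ ∨ w = ⟨1, u⟩ ∨ w = ⟨1, v⟩ ∨ w = ⟨2, p'.comp e.toRingHom⟩ := by
    simpa [hPdef] using hwP
  rcases hwP' with rfl | rfl | rfl | rfl
  · exact hw0 rfl
  · -- partner `(1, u)`
    obtain ⟨s₁, hs₁u, hs₁v⟩ := exists_ringAut_smul_eq_self_smul_eq_conjugate_of_not_isGalois h4₁ hK₁ hvu hvu'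
    have h1 : s₁ • p ∈ (Φ 0).1 ↔ ¬s₁ • u ∈ (Φ 1).1 := hone s₁
    have h2 : (s₁ * σ) • p ∈ (Φ 0).1 ↔ ¬(s₁ * σ) • u ∈ (Φ 1).1 := hone (s₁ * σ)
    rw [hs₁u] at h1
    rw [mul_smul, mul_smul, hσp, hσu, hs₁v] at h2
    exact (h1.not.2 (not_not.2 hu)) (h2.2 hnv)
  · -- partner `(1, v)`
    obtain ⟨s₂, hs₂v, hs₂u⟩ := exists_ringAut_smul_eq_self_smul_eq_conjugate_of_not_isGalois h4₁ hK₁ huv huv'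
    have h1 : s₂ • p ∈ (Φ 0).1 ↔ ¬s₂ • v ∈ (Φ 1).1 := hone s₂
    have h2 : (s₂ * σ) • p ∈ (Φ 0).1 ↔ ¬(s₂ * σ) • v ∈ (Φ 1).1 := hone (s₂ * σ)
    rw [hs₂v] at h1
    rw [mul_smul, mul_smul, hσp, hσv, hs₂u] at h2
    exact (h1.not.2 (not_not.2 hv)) (h2.2 hnu)
  · -- partner `(2, p′∘e)`
    have h1 : (1 : ℂ ≃+* ℂ) • p ∈ (Φ 0).1 ↔ ¬(1 : ℂ ≃+* ℂ) • p'.comp e.toRingHom ∈ (Φ 2).1 := hone 1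
    rw [one_smul, one_smul] at h1
    exact hpΦ (h1.2 hp'Φ)

end Triple

end DihedralReflexTriple

end Summit.HodgeConjecture.CorCM

end
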